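import Literature.Analysis.FluidPDE.LerayHopfProofs
import Literature.Analysis.FluidPDE.WholeSpaceIBP
import Literature.Analysis.FunctionSpaces.DuBoisReymond
import HarnessLib

/-!
# The time-sliced weak formulation of Leray–Hopf solutions

Analysis/FluidPDE support file (serves the discharge of the Serrin–Prodi weak–strong uniqueness
theorem `Literature.Analysis.FluidPDE.weak_strong_uniqueness`, sub-fact `Literature.Analysis.FluidPDE.serrin_difference_energy_ineq`).

The accepted `Fluid.IsWeakNSSolutionOn` is the space–time (Leray) formulation: one identity for
every smooth compactly supported divergence-free space–time test field on `(-∞, T) × E`. The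
uniqueness argument of Serrin needs the **time-sliced** form: for a fixed smooth compactly
supported divergence-free field `Ψ` on `E` and every time `t`,
`⟨u(t), Ψ⟩ = ⟨u₀, Ψ⟩ + ∫₀ᵗ ∫ (⟪u, (u·∇)Ψ⟫ + ν ⟪u, ΔΨ⟫) ds`
(Serrin 1963, §3, (6); Galdi 2000, Lemma 2.1 / Definition 2.1; Robinson–Rodrigo–Sadowski 2016,
(3.3)–(3.4) and Lemma 3.? "equivalent weak formulations"). We prove it for Leray–Hopf solutions of
the unforced system (`f = 0`):

* `IsWeakNSSolutionOn.test_smul`: testing the space–time formulation with `ψ(s,x) = η(s) Ψ(x)`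
  gives `∫_{(0,T)} (η' U + η F) + η(0) ⟨u₀,Ψ⟩ = 0` with `U(s) = ⟨u(s),Ψ⟩`,
  `F(s) = ∫ (⟪u, (u·∇)Ψ⟫ + ν⟪u, ΔΨ⟫)`;
* `IsLerayHopfOn.inner_test_eq` : for a Leray–Hopf solution, `U(t) = ⟨u₀,Ψ⟩ + ∫_{(0,t]} F` for
  **every** `t ∈ (0, T]`, by the du Bois-Reymond lemma with initial datum
  (`Literature.Analysis.FunctionSpaces.eq_add_setIntegral_of_forall_test`) and the weak `L²`-continuity clause of
  `IsLerayHopfOn` (which supplies the continuous representative and the endpoint `t = T`).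

## Mathlib search

Nothing on Navier–Stokes weak formulations in Mathlib; the tree has the space–time formulation
(`WeakSolution`), its classical instances (`WeakSolutionProofs`, `LerayHopfProofs`) and the
whole-space calculus (`WholeSpaceIBP`), but no time-sliced form (searched `slice`, `timeSlice`,
`inner_test` in `Literature/Analysis/FluidPDE`).

## References

* J. Serrin, *The initial value problem for the Navier–Stokes equations*, in: Nonlinear Problems
  (Madison 1962), Univ. Wisconsin Press 1963, §3.
* G. P. Galdi, *An introduction to the Navier–Stokes initial-boundary value problem*, in:
  Fundamental Directions in Mathematical Fluid Mechanics, Birkhäuser 2000, §2, Lemma 2.1.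
* J. C. Robinson, J. L. Rodrigo, W. Sadowski, *The three-dimensional Navier–Stokes equations*
  (CUP 2016), Def. 3.3 and (3.3)–(3.4).
-/

noncomputable section

open MeasureTheory TopologicalSpace Set Function Filter Topology InnerProductSpace
open scoped RealInnerProductSpace ENNReal NNReal Laplacian ContDiff

namespace Literature.Analysis.FluidPDE

variable {E : Type*} [NormedAddCommGroup E] [InnerProductSpace ℝ E] [FiniteDimensional ℝ E]
  [MeasurableSpace E] [BorelSpace E]

/-! ### Product test fields `η(s) Ψ(x)` -/

section TestField

omit [MeasurableSpace E] [BorelSpace E] [FiniteDimensional ℝ E] in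
/-- The product `ψ(s,x) = η(s) Ψ(x)` of a smooth compactly supported `η` with `supp η ⊆ (-∞,T)`
and a test field `Ψ` on `E` is a space–time test field on the slab `(-∞, T) × E`. [folklore] -/
theorem isSpaceTimeTestOn_smul {T : ℝ} {η : ℝ → ℝ} (hη : ContDiff ℝ ∞ η)
    (hηc : HasCompactSupport η) (hηT : tsupport η ⊆ Iio T) {Ψ : E → E}
    (hΨ : FunctionSpaces.IsTestFunctionOn (⊤ : Opens E) Ψ) :
    IsSpaceTimeTestOn (slab E (Iio T) isOpen_Iio) (fun s x => η s • Ψ x) where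
  contDiff := (hη.comp contDiff_fst).smul (hΨ.contDiff.comp contDiff_snd)
  hasCompactSupport := by
    refine HasCompactSupport.intro (hηc.prod hΨ.hasCompactSupport) ?_
    rintro ⟨s, x⟩ hp
    rcases not_and_or.1 (fun h => hp (mem_prod.2 h)) with h | h
    · simp [uncurry, image_eq_zero_of_notMem_tsupport h]
    · simp [uncurry, image_eq_zero_of_notMem_tsupport h]
  tsupport_subset := by
    intro p hp
    have hp' : p ∈ tsupport η ×ˢ (univ : Set E) := by
      refine closure_minimal (fun q hq => ?_) ((isClosed_tsupport η).prod isClosed_univ) hp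
      refine ⟨subset_tsupport _ fun h0 => hq ?_, mem_univ _⟩
      simp [uncurry, h0]
    change p ∈ (Iio T) ×ˢ (univ : Set E)
    exact ⟨hηT hp'.1, mem_univ _⟩

omit [MeasurableSpace E] [BorelSpace E] in
/-- A constant multiple of a divergence-free differentiable field is divergence free. [folklore] -/
theorem isDivFree_const_smul {Ψ : E → E} (hΨ : VectorCalculus.IsDivFree Ψ) (hΨd : Differentiable ℝ Ψ) (c : ℝ) :
    VectorCalculus.IsDivFree fun x => c • Ψ x := by
  intro x
  have h := divergence_smul_apply (θ := fun _ => c) (u := Ψ) (x := x)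
    (differentiableAt_const c) (hΨd x)
  rw [h, hΨ x, mul_zero, zero_add]
  have : gradient (fun _ : E => c) x = 0 := by
    rw [gradient, fderiv_const_apply]; simp
  rw [this, inner_zero_right]

omit [MeasurableSpace E] [BorelSpace E] [FiniteDimensional ℝ E] [InnerProductSpace ℝ E] in
/-- Time derivative of a product test field: `∂ₜ (η(s) Ψ(x)) = η'(s) Ψ(x)`. [folklore] -/
theorem timeDeriv_smul [NormedSpace ℝ E] {η : ℝ → ℝ} (hη : Differentiable ℝ η) (Ψ : E → E)
    (s : ℝ) (x : E) :
    timeDeriv (fun s x => η s • Ψ x) s x = deriv η s • Ψ x := by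
  simp only [timeDeriv_apply]
  exact deriv_smul_const (hη s) (Ψ x)

omit [MeasurableSpace E] [BorelSpace E] [FiniteDimensional ℝ E] in
/-- Convective derivative of a product test field: `(u·∇)(η(s) Ψ) = η(s) (u·∇)Ψ`. [folklore] -/
theorem convect_const_smul (u : E → E) {Ψ : E → E} (hΨd : Differentiable ℝ Ψ) (c : ℝ) (x : E) :
    convect u (fun y => c • Ψ y) x = c • convect u Ψ x := by
  have h := convect_smul_apply (θ := fun _ => c) (u := u) (w := Ψ) (x := x)
    (differentiableAt_const c) (hΨd x)
  rw [h, fderiv_const_apply]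
  simp

omit [MeasurableSpace E] [BorelSpace E] in
/-- Laplacian of a product test field: `Δ (η(s) Ψ) = η(s) ΔΨ` for `C²` fields. [folklore] -/
theorem laplacian_const_smul {Ψ : E → E} (hΨ : ContDiff ℝ 2 Ψ) (c : ℝ) (x : E) :
    (Δ fun y => c • Ψ y) x = c • (Δ Ψ) x := by
  have : (fun y => c • Ψ y) = c • Ψ := rfl
  rw [this]
  exact laplacian_smul c hΨ.contDiffAt

end TestField

/-! ### Integrability of the pairings of an `L²` slice with a test field -/

section Integrability

variable {F' : Type*} [NormedAddCommGroup F'] [InnerProductSpace ℝ F']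

-- `integrable_inner_of_memLp_two` (the pairing of two `L²` functions is integrable) is the
-- accepted lemma of `FluidPDE/LerayHopfProofs`.

/-- A test field is in every `L^p`. [folklore] -/
theorem _root_.Literature.Analysis.FunctionSpaces.IsTestFunctionOn.memLp_volume {Ψ : E → F'}
    (hΨ : FunctionSpaces.IsTestFunctionOn (⊤ : Opens E) Ψ) (p : ℝ≥0∞) : MemLp Ψ p (volume : Measure E) :=
  hΨ.contDiff.continuous.memLp_of_hasCompactSupport hΨ.hasCompactSupport

/-- The Laplacian of a test field is a compactly supported continuous function, hence in every
`L^p`. [folklore] -/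
theorem _root_.Literature.Analysis.FunctionSpaces.IsTestFunctionOn.memLp_laplacian {Ψ : E → F'}
    (hΨ : FunctionSpaces.IsTestFunctionOn (⊤ : Opens E) Ψ) (p : ℝ≥0∞) : MemLp (Δ Ψ) p (volume : Measure E) := by
  have h2 : ContDiff ℝ 2 Ψ := contDiff_infty.1 hΨ.contDiff 2
  refine (continuous_laplacian h2).memLp_of_hasCompactSupport ?_
  refine hΨ.hasCompactSupport.mono' fun x hx => ?_
  by_contra h
  exact hx (laplacian_eq_zero_of_notMem_tsupport h)

omit [FiniteDimensional ℝ E] [MeasurableSpace E] [BorelSpace E] in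
/-- The derivative of a test field is bounded. [folklore] -/
theorem _root_.Literature.Analysis.FunctionSpaces.IsTestFunctionOn.exists_norm_fderiv_le {Ψ : E → F'}
    (hΨ : FunctionSpaces.IsTestFunctionOn (⊤ : Opens E) Ψ) : ∃ C, ∀ x, ‖fderiv ℝ Ψ x‖ ≤ C :=
  (hΨ.contDiff.continuous_fderiv (by simp)).bounded_above_of_compact_support
    (hΨ.hasCompactSupport.fderiv ℝ)

/-- The pairing `⟪v, DΨ · w⟫` of two `L²` fields through the (bounded) derivative of a test field
is integrable: `|⟪v, DΨ w⟫| ≤ ‖DΨ‖_∞ ‖v‖ ‖w‖`. [folklore] -/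
theorem integrable_inner_fderiv_apply_of_memLp_two {v : E → F'} {w : E → E} {Ψ : E → F'}
    (hv : MemLp v 2 volume) (hw : MemLp w 2 volume) (hΨ : FunctionSpaces.IsTestFunctionOn (⊤ : Opens E) Ψ) :
    Integrable (fun x => ⟪v x, fderiv ℝ Ψ x (w x)⟫) (volume : Measure E) := by
  obtain ⟨C, hC⟩ := hΨ.exists_norm_fderiv_le
  have hA : Continuous (fderiv ℝ Ψ) := hΨ.contDiff.continuous_fderiv (by simp)
  have hAw : AEStronglyMeasurable (fun x => fderiv ℝ Ψ x (w x)) volume :=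
    isBoundedBilinearMap_apply.continuous.comp_aestronglyMeasurable
      (hA.aestronglyMeasurable.prodMk hw.1)
  have hprod : MemLp ((fun x => ‖v x‖) * fun x => ‖w x‖) 1 volume := hw.norm.mul hv.norm
  rw [memLp_one_iff_integrable] at hprod
  refine (hprod.const_mul C).mono' (hv.1.inner hAw) (Eventually.of_forall fun x => ?_)
  calc ‖⟪v x, fderiv ℝ Ψ x (w x)⟫‖ ≤ ‖v x‖ * ‖fderiv ℝ Ψ x (w x)‖ := norm_inner_le_norm (𝕜 := ℝ) _ _
    _ ≤ ‖v x‖ * (C * ‖w x‖) := by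
        gcongr
        exact (ContinuousLinearMap.le_opNorm _ _).trans (by gcongr; exact hC x)
    _ = C * (‖v x‖ * ‖w x‖) := by ring
    _ = C * ((fun x => ‖v x‖) * fun x => ‖w x‖) x := rfl

end Integrability

/-! ### The time-sliced weak formulation -/

section Slice

variable {T ν : ℝ} {u₀ : E → E} {u : ℝ → E → E}

/-- **The space–time weak formulation tested with a product field.** Let `u` be a weak solution
of the unforced Navier–Stokes system on `E × [0, T)` (accepted `IsWeakNSSolutionOn`, `f = 0`)
whose slices `u(s)`, `s ∈ (0,T)`, are square integrable, let `Ψ ∈ C_c^∞(E; E)` be divergence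
free and `η ∈ C_c^∞(ℝ)` with `supp η ⊆ (-∞, T)`. Testing with `ψ(s,x) = η(s)Ψ(x)` gives
`∫_{(0,T)} (η'(s) ⟨u(s),Ψ⟩ + η(s) ∫(⟪u,(u·∇)Ψ⟫ + ν⟪u,ΔΨ⟫)) ds + η(0)⟨u₀,Ψ⟩ = 0`
(Serrin 1963, §3; Galdi 2000, proof of Lemma 2.1: `∂ₜψ = η'Ψ`, `(u·∇)ψ = η (u·∇)Ψ`,
`Δψ = η ΔΨ`, and the `x`-integral is linear because each pairing is integrable). [folklore] -/
theorem IsWeakNSSolutionOn.test_smul (hu : IsWeakNSSolutionOn T ν 0 u₀ u)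
    (hL2 : ∀ s ∈ Ioo 0 T, MemLp (u s) 2 volume)
    {Ψ : E → E} (hΨ : FunctionSpaces.IsTestFunctionOn (⊤ : Opens E) Ψ) (hΨdiv : VectorCalculus.IsDivFree Ψ)
    {η : ℝ → ℝ} (hη : ContDiff ℝ ∞ η) (hηc : HasCompactSupport η) (hηT : tsupport η ⊆ Iio T) :
    (∫ s in Ioo 0 T, ((deriv η s * ∫ x, ⟪u s x, Ψ x⟫) +
        η s * ∫ x, (⟪u s x, convect (u s) Ψ x⟫ + ν * ⟪u s x, (Δ Ψ) x⟫))) +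
      η 0 * ∫ x, ⟪u₀ x, Ψ x⟫ = 0 := by
  obtain ⟨-, -, -, hweak⟩ := hu
  have hΨd : Differentiable ℝ Ψ := hΨ.contDiff.differentiable (by simp)
  have hΨ2 : ContDiff ℝ 2 Ψ := contDiff_infty.1 hΨ.contDiff 2
  have hηd : Differentiable ℝ η := hη.differentiable (by simp)
  have key := hweak (fun s x => η s • Ψ x) (isSpaceTimeTestOn_smul hη hηc hηT hΨ)
    (fun s => isDivFree_const_smul hΨdiv hΨd (η s))
  have hinit : ∫ x, ⟪u₀ x, η 0 • Ψ x⟫ = η 0 * ∫ x, ⟪u₀ x, Ψ x⟫ := by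
    simp only [real_inner_smul_right]
    exact MeasureTheory.integral_const_mul _ _
  have hslice : ∀ s ∈ Ioo 0 T,
      ∫ x, (⟪u s x, timeDeriv (fun s x => η s • Ψ x) s x⟫ +
        ⟪u s x, convect (u s) (fun x => η s • Ψ x) x⟫ +
        ν * ⟪u s x, (Δ fun x => η s • Ψ x) x⟫ + ⟪(0 : ℝ → E → E) s x, η s • Ψ x⟫) =
      (deriv η s * ∫ x, ⟪u s x, Ψ x⟫) +
        η s * ∫ x, (⟪u s x, convect (u s) Ψ x⟫ + ν * ⟪u s x, (Δ Ψ) x⟫) := by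
    intro s hs
    have i1 : Integrable (fun x => ⟪u s x, Ψ x⟫) volume :=
      integrable_inner_of_memLp_two (hL2 s hs) (hΨ.memLp_volume 2)
    have i2 : Integrable (fun x => ⟪u s x, convect (u s) Ψ x⟫ + ν * ⟪u s x, (Δ Ψ) x⟫) volume :=
      (integrable_inner_fderiv_apply_of_memLp_two (hL2 s hs) (hL2 s hs) hΨ).add
        ((integrable_inner_of_memLp_two (hL2 s hs) (hΨ.memLp_laplacian 2)).const_mul ν)
    have hpt : (fun x => ⟪u s x, timeDeriv (fun s x => η s • Ψ x) s x⟫ +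
        ⟪u s x, convect (u s) (fun x => η s • Ψ x) x⟫ +
        ν * ⟪u s x, (Δ fun x => η s • Ψ x) x⟫ + ⟪(0 : ℝ → E → E) s x, η s • Ψ x⟫) =
        fun x => deriv η s * ⟪u s x, Ψ x⟫ +
          η s * (⟪u s x, convect (u s) Ψ x⟫ + ν * ⟪u s x, (Δ Ψ) x⟫) := by
      ext x
      rw [timeDeriv_smul hηd, convect_const_smul (u s) hΨd, laplacian_const_smul hΨ2]
      simp only [real_inner_smul_right, Pi.zero_apply, inner_zero_left, add_zero]
      ring
    rw [hpt, integral_add (i1.const_mul _) (i2.const_mul _), MeasureTheory.integral_const_mul,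
      MeasureTheory.integral_const_mul]
  rw [setIntegral_congr_fun measurableSet_Ioo hslice, hinit] at key
  exact key

/-- The product measure `(vol|_(0,T)) × vol` on `ℝ × E` is the restriction of the volume to the
slab `(0,T) × E`. [folklore] -/
theorem restrict_prod_volume_eq (T : ℝ) :
    ((volume : Measure ℝ).restrict (Ioo 0 T)).prod (volume : Measure E) =
      (volume : Measure (ℝ × E)).restrict (Ioo 0 T ×ˢ univ) := by
  rw [Measure.volume_eq_prod, ← Measure.prod_restrict, Measure.restrict_univ]

variable {F' : Type*} [NormedAddCommGroup F'] [InnerProductSpace ℝ F']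

/-- `|∫ ⟪v, g⟫| ≤ E(v) + E(g)` for `L²` fields (`|⟪a,b⟫| ≤ ½‖a‖² + ½‖b‖²`). [folklore] -/
theorem abs_integral_inner_le_kineticEnergy_add {v g : E → F'} (hv : MemLp v 2 volume)
    (hg : MemLp g 2 volume) :
    |∫ x, ⟪v x, g x⟫| ≤ VectorCalculus.kineticEnergy v + VectorCalculus.kineticEnergy g := by
  have iv : Integrable (fun x => ‖v x‖ ^ 2) volume := (memLp_two_iff_integrable_sq_norm hv.1).1 hv
  have ig : Integrable (fun x => ‖g x‖ ^ 2) volume := (memLp_two_iff_integrable_sq_norm hg.1).1 hg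
  calc |∫ x, ⟪v x, g x⟫| ≤ ∫ x, |⟪v x, g x⟫| := by
        simpa only [← Real.norm_eq_abs] using MeasureTheory.norm_integral_le_integral_norm _
    _ ≤ ∫ x, 2⁻¹ * (‖v x‖ ^ 2 + ‖g x‖ ^ 2) := by
        refine integral_mono_of_nonneg (Eventually.of_forall fun x => abs_nonneg _)
          ((iv.add ig).const_mul _) (Eventually.of_forall fun x => ?_)
        have h1 : |⟪v x, g x⟫| ≤ ‖v x‖ * ‖g x‖ := abs_real_inner_le_norm _ _
        nlinarith [two_mul_le_add_sq ‖v x‖ ‖g x‖]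
    _ = VectorCalculus.kineticEnergy v + VectorCalculus.kineticEnergy g := by
        rw [MeasureTheory.integral_const_mul, integral_add iv ig, VectorCalculus.kineticEnergy, VectorCalculus.kineticEnergy]
        ring

/-- `|∫ ⟪v, DΨ · v⟫| ≤ 2‖DΨ‖_∞ E(v)` for an `L²` field and a test field. [folklore] -/
theorem abs_integral_inner_fderiv_apply_le {v : E → E} {Ψ : E → E} (hv : MemLp v 2 volume)
    {C : ℝ} (hC : ∀ x, ‖fderiv ℝ Ψ x‖ ≤ C) :
    |∫ x, ⟪v x, fderiv ℝ Ψ x (v x)⟫| ≤ 2 * C * VectorCalculus.kineticEnergy v := by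
  have iv : Integrable (fun x => ‖v x‖ ^ 2) volume := (memLp_two_iff_integrable_sq_norm hv.1).1 hv
  calc |∫ x, ⟪v x, fderiv ℝ Ψ x (v x)⟫| ≤ ∫ x, |⟪v x, fderiv ℝ Ψ x (v x)⟫| := by
        simpa only [← Real.norm_eq_abs] using MeasureTheory.norm_integral_le_integral_norm _
    _ ≤ ∫ x, C * ‖v x‖ ^ 2 := by
        refine integral_mono_of_nonneg (Eventually.of_forall fun x => abs_nonneg _)
          (iv.const_mul _) (Eventually.of_forall fun x => ?_)
        calc |⟪v x, fderiv ℝ Ψ x (v x)⟫| ≤ ‖v x‖ * ‖fderiv ℝ Ψ x (v x)‖ :=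
              abs_real_inner_le_norm _ _
          _ ≤ ‖v x‖ * (C * ‖v x‖) := by
              gcongr
              exact (ContinuousLinearMap.le_opNorm _ _).trans (by gcongr; exact hC x)
          _ = C * ‖v x‖ ^ 2 := by ring
    _ = 2 * C * VectorCalculus.kineticEnergy v := by
        rw [MeasureTheory.integral_const_mul, VectorCalculus.kineticEnergy]
        ring

/-- The pairing `s ↦ ⟨u(s), Ψ⟩` of a Leray–Hopf solution with an `L²` field is a.e.-strongly
measurable on `(0, T)` (joint measurability of `u` and Fubini). [folklore] -/
theorem IsLerayHopfOn.aestronglyMeasurable_inner {f : ℝ → E → E} (hu : IsLerayHopfOn T ν f u₀ u)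
    {Ψ : E → E} (hΨ : AEStronglyMeasurable Ψ (volume : Measure E)) :
    AEStronglyMeasurable (fun s => ∫ x, ⟪u s x, Ψ x⟫) (volume.restrict (Ioo 0 T)) := by
  have hu' : AEStronglyMeasurable (uncurry u)
      (((volume : Measure ℝ).restrict (Ioo 0 T)).prod (volume : Measure E)) := by
    rw [restrict_prod_volume_eq]; exact hu.weak.1
  have h1 : AEStronglyMeasurable (fun p : ℝ × E => ⟪uncurry u p, Ψ p.2⟫)
      (((volume : Measure ℝ).restrict (Ioo 0 T)).prod (volume : Measure E)) :=
    hu'.inner hΨ.comp_snd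
  exact h1.integral_prod_right'

/-- The flux `s ↦ ∫ (⟪u, (u·∇)Ψ⟫ + ν⟪u, ΔΨ⟫)` of a Leray–Hopf solution against a test field is
a.e.-strongly measurable on `(0, T)`. [folklore] -/
theorem IsLerayHopfOn.aestronglyMeasurable_flux {f : ℝ → E → E} (hu : IsLerayHopfOn T ν f u₀ u)
    {Ψ : E → E} (hΨ : FunctionSpaces.IsTestFunctionOn (⊤ : Opens E) Ψ) :
    AEStronglyMeasurable (fun s => ∫ x, (⟪u s x, convect (u s) Ψ x⟫ + ν * ⟪u s x, (Δ Ψ) x⟫))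
      (volume.restrict (Ioo 0 T)) := by
  have hu' : AEStronglyMeasurable (uncurry u)
      (((volume : Measure ℝ).restrict (Ioo 0 T)).prod (volume : Measure E)) := by
    rw [restrict_prod_volume_eq]; exact hu.weak.1
  have hA : Continuous fun p : ℝ × E => fderiv ℝ Ψ p.2 :=
    (hΨ.contDiff.continuous_fderiv (by simp)).comp continuous_snd
  have hAu : AEStronglyMeasurable (fun p : ℝ × E => fderiv ℝ Ψ p.2 (uncurry u p))
      (((volume : Measure ℝ).restrict (Ioo 0 T)).prod (volume : Measure E)) :=
    isBoundedBilinearMap_apply.continuous.comp_aestronglyMeasurable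
      (hA.aestronglyMeasurable.prodMk hu')
  have hL : AEStronglyMeasurable (fun p : ℝ × E => (Δ Ψ) p.2)
      (((volume : Measure ℝ).restrict (Ioo 0 T)).prod (volume : Measure E)) :=
    ((continuous_laplacian (contDiff_infty.1 hΨ.contDiff 2)).comp
      continuous_snd).aestronglyMeasurable
  have h1 : AEStronglyMeasurable
      (fun p : ℝ × E => ⟪uncurry u p, fderiv ℝ Ψ p.2 (uncurry u p)⟫ + ν * ⟪uncurry u p, (Δ Ψ) p.2⟫)
      (((volume : Measure ℝ).restrict (Ioo 0 T)).prod (volume : Measure E)) :=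
    (hu'.inner hAu).add ((hu'.inner hL).const_mul ν)
  exact h1.integral_prod_right'

/-- **A.e. energy bound in real form**: for a Leray–Hopf solution, `E(u(s)) ≤ C` for a.e.
`s ∈ (0,T)` with a real constant (from the `L^∞(0,T;L²)` clause and `eEnergy = 2E` on `L²`
slices). [folklore] -/
theorem IsLerayHopfOn.exists_kineticEnergy_le {f : ℝ → E → E} (hu : IsLerayHopfOn T ν f u₀ u) :
    ∃ C : ℝ, ∀ᵐ s ∂(volume.restrict (Ioo 0 T)), VectorCalculus.kineticEnergy (u s) ≤ C := by
  obtain ⟨C, hC⟩ := hu.energy_bound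
  refine ⟨(C : ℝ) / 2, ?_⟩
  filter_upwards [hC, ae_restrict_mem measurableSet_Ioo] with s hs hsI
  have hmem : MemLp (u s) 2 volume := hu.memLp s (Ioo_subset_Icc_self hsI)
  rw [eEnergy_eq_ofReal _ hmem] at hs
  have h2 : 2 * VectorCalculus.kineticEnergy (u s) ≤ C := by
    have := ENNReal.toReal_mono ENNReal.coe_ne_top hs
    rwa [ENNReal.toReal_ofReal (mul_nonneg zero_le_two (kineticEnergy_nonneg (u s))),
      ENNReal.coe_toReal] at this
  linarith

/-- The pairing `s ↦ ⟨u(s), Ψ⟩` of a Leray–Hopf solution with a test field is integrable on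
`(0, T)` (bounded a.e. by the energy). [folklore] -/
theorem IsLerayHopfOn.integrableOn_inner {f : ℝ → E → E} (hu : IsLerayHopfOn T ν f u₀ u)
    {Ψ : E → E} (hΨ : FunctionSpaces.IsTestFunctionOn (⊤ : Opens E) Ψ) :
    IntegrableOn (fun s => ∫ x, ⟪u s x, Ψ x⟫) (Ioo 0 T) := by
  obtain ⟨C, hC⟩ := hu.exists_kineticEnergy_le
  refine ⟨hu.aestronglyMeasurable_inner (hΨ.memLp_volume 2).1, ?_⟩
  refine HasFiniteIntegral.of_bounded (C := C + VectorCalculus.kineticEnergy Ψ) ?_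
  filter_upwards [hC, ae_restrict_mem measurableSet_Ioo] with s hs hsI
  rw [Real.norm_eq_abs]
  exact (abs_integral_inner_le_kineticEnergy_add (hu.memLp s (Ioo_subset_Icc_self hsI))
    (hΨ.memLp_volume 2)).trans (by linarith)

/-- The flux `s ↦ ∫ (⟪u, (u·∇)Ψ⟫ + ν⟪u, ΔΨ⟫)` of a Leray–Hopf solution against a test field is
integrable on `(0, T)` (bounded a.e. by the energy). [folklore] -/
theorem IsLerayHopfOn.integrableOn_flux {f : ℝ → E → E} (hu : IsLerayHopfOn T ν f u₀ u)
    {Ψ : E → E} (hΨ : FunctionSpaces.IsTestFunctionOn (⊤ : Opens E) Ψ) :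
    IntegrableOn (fun s => ∫ x, (⟪u s x, convect (u s) Ψ x⟫ + ν * ⟪u s x, (Δ Ψ) x⟫))
      (Ioo 0 T) := by
  obtain ⟨C, hC⟩ := hu.exists_kineticEnergy_le
  obtain ⟨D, hD⟩ := hΨ.exists_norm_fderiv_le
  refine ⟨hu.aestronglyMeasurable_flux hΨ, ?_⟩
  refine HasFiniteIntegral.of_bounded
    (C := 2 * |D| * |C| + |ν| * (|C| + VectorCalculus.kineticEnergy (Δ Ψ))) ?_
  filter_upwards [hC, ae_restrict_mem measurableSet_Ioo] with s hs hsI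
  have hmem : MemLp (u s) 2 volume := hu.memLp s (Ioo_subset_Icc_self hsI)
  have i1 : Integrable (fun x => ⟪u s x, convect (u s) Ψ x⟫) volume :=
    integrable_inner_fderiv_apply_of_memLp_two hmem hmem hΨ
  have i2 : Integrable (fun x => ⟪u s x, (Δ Ψ) x⟫) volume :=
    integrable_inner_of_memLp_two hmem (hΨ.memLp_laplacian 2)
  rw [Real.norm_eq_abs, integral_add i1 (i2.const_mul ν), MeasureTheory.integral_const_mul]
  have hK := kineticEnergy_nonneg (u s)
  have hKC : VectorCalculus.kineticEnergy (u s) ≤ |C| := hs.trans (le_abs_self C)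
  have b1 : |∫ x, ⟪u s x, convect (u s) Ψ x⟫| ≤ 2 * |D| * |C| := by
    have := abs_integral_inner_fderiv_apply_le hmem (fun x => (hD x).trans (le_abs_self D))
    simp only [convect_apply] at this ⊢
    calc _ ≤ 2 * |D| * VectorCalculus.kineticEnergy (u s) := this
      _ ≤ 2 * |D| * |C| := by gcongr
  have b2 : |ν * ∫ x, ⟪u s x, (Δ Ψ) x⟫| ≤ |ν| * (|C| + VectorCalculus.kineticEnergy (Δ Ψ)) := by
    rw [abs_mul]
    gcongr
    exact (abs_integral_inner_le_kineticEnergy_add hmem (hΨ.memLp_laplacian 2)).trans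
      (by linarith)
  exact (abs_add_le _ _).trans (add_le_add b1 b2)

/-- **The time-sliced weak formulation of a Leray–Hopf solution.** Let `u` be a Leray–Hopf weak
solution of the unforced Navier–Stokes system on `E × [0, T)`, `T > 0`, with datum `u₀`, and let
`Ψ ∈ C_c^∞(E; E)` be divergence free. Then for **every** `t ∈ (0, T]`
`⟨u(t), Ψ⟩ = ⟨u₀, Ψ⟩ + ∫_{(0,t]} ∫ (⟪u, (u·∇)Ψ⟫ + ν ⟪u, ΔΨ⟫) dx ds`
(Serrin 1963, §3, (6); Galdi 2000, Lemma 2.1; Robinson–Rodrigo–Sadowski 2016, (3.3)–(3.4)).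
Proof: `IsWeakNSSolutionOn.test_smul` feeds the du Bois-Reymond lemma with initial datum
(`Literature.Analysis.FunctionSpaces.eq_add_setIntegral_of_forall_test`), the continuous representative being supplied by the
weak `L²`-continuity clause of `IsLerayHopfOn` on `(0, T]`; the endpoint `t = T` follows by
letting `t → T⁻`. [folklore] -/
theorem IsLerayHopfOn.inner_test_eq (hu : IsLerayHopfOn T ν 0 u₀ u) (hT : 0 < T)
    {Ψ : E → E} (hΨ : FunctionSpaces.IsTestFunctionOn (⊤ : Opens E) Ψ) (hΨdiv : VectorCalculus.IsDivFree Ψ)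
    {t : ℝ} (ht : t ∈ Ioc 0 T) :
    ∫ x, ⟪u t x, Ψ x⟫ = (∫ x, ⟪u₀ x, Ψ x⟫) +
      ∫ s in Ioc 0 t, ∫ x, (⟪u s x, convect (u s) Ψ x⟫ + ν * ⟪u s x, (Δ Ψ) x⟫) := by
  have hUint := hu.integrableOn_inner hΨ
  have hFint := hu.integrableOn_flux hΨ
  have hUcont : ContinuousOn (fun s => ∫ x, ⟪u s x, Ψ x⟫) (Ioc 0 T) :=
    (hu.weak_continuous Ψ (hΨ.memLp_volume 2)).1
  have hid : ∀ η : ℝ → ℝ, ContDiff ℝ ∞ η → HasCompactSupport η → tsupport η ⊆ Iio T →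
      (∫ s in Ioo 0 T, (deriv η s * (∫ x, ⟪u s x, Ψ x⟫) +
        η s * ∫ x, (⟪u s x, convect (u s) Ψ x⟫ + ν * ⟪u s x, (Δ Ψ) x⟫))) +
        η 0 * (∫ x, ⟪u₀ x, Ψ x⟫) = 0 := fun η hη hηc hηT =>
    hu.weak.test_smul (fun s hs => hu.memLp s (Ioo_subset_Icc_self hs)) hΨ hΨdiv hη hηc hηT
  have hIoo : ∀ t ∈ Ioo 0 T, ∫ x, ⟪u t x, Ψ x⟫ = (∫ x, ⟪u₀ x, Ψ x⟫) +
      ∫ s in Ioc 0 t, ∫ x, (⟪u s x, convect (u s) Ψ x⟫ + ν * ⟪u s x, (Δ Ψ) x⟫) := fun t ht =>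
    FunctionSpaces.eq_add_setIntegral_of_forall_test hUint hFint (hUcont.mono Ioo_subset_Ioc_self) hid ht
  rcases lt_or_eq_of_le ht.2 with htT | rfl
  · exact hIoo t ⟨ht.1, htT⟩
  · -- the endpoint: both sides are limits from the left within `(0, T)`
    haveI : (𝓝[Ioo 0 t] t).NeBot := by
      refine mem_closure_iff_nhdsWithin_neBot.1 ?_
      rw [closure_Ioo hT.ne]
      exact right_mem_Icc.2 hT.le
    have h1 : Tendsto (fun s => ∫ x, ⟪u s x, Ψ x⟫) (𝓝[Ioo 0 t] t) (𝓝 (∫ x, ⟪u t x, Ψ x⟫)) :=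
      (hUcont t ⟨hT, le_rfl⟩).mono Ioo_subset_Ioc_self
    have hFint' : IntegrableOn
        (fun s => ∫ x, (⟪u s x, convect (u s) Ψ x⟫ + ν * ⟪u s x, (Δ Ψ) x⟫)) (Icc 0 t) :=
      (integrableOn_Icc_iff_integrableOn_Ioo (by simp) (by simp)).2 hFint
    have h2 : Tendsto (fun τ => (∫ x, ⟪u₀ x, Ψ x⟫) +
        ∫ s in Ioc 0 τ, ∫ x, (⟪u s x, convect (u s) Ψ x⟫ + ν * ⟪u s x, (Δ Ψ) x⟫)) (𝓝[Ioo 0 t] t)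
        (𝓝 ((∫ x, ⟪u₀ x, Ψ x⟫) +
          ∫ s in Ioc 0 t, ∫ x, (⟪u s x, convect (u s) Ψ x⟫ + ν * ⟪u s x, (Δ Ψ) x⟫))) := by
      have hprim : ContinuousWithinAt (fun τ => ∫ s in Ioc 0 τ,
          ∫ x, (⟪u s x, convect (u s) Ψ x⟫ + ν * ⟪u s x, (Δ Ψ) x⟫)) (Ioo 0 t) t :=
        (intervalIntegral.continuousOn_primitive hFint' t (right_mem_Icc.2 hT.le)).mono
          Ioo_subset_Icc_self
      exact tendsto_const_nhds.add hprim
    have heq : (fun s => ∫ x, ⟪u s x, Ψ x⟫) =ᶠ[𝓝[Ioo 0 t] t] fun τ => (∫ x, ⟪u₀ x, Ψ x⟫) +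
        ∫ s in Ioc 0 τ, ∫ x, (⟪u s x, convect (u s) Ψ x⟫ + ν * ⟪u s x, (Δ Ψ) x⟫) :=
      eventually_mem_nhdsWithin.mono fun τ hτ => hIoo τ hτ
    exact tendsto_nhds_unique (h1.congr' heq) h2

end Slice

end Literature.Analysis.FluidPDE
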